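import Literature.Algebra.Homology.VanishingBaseChangeOfQuasiIso
import Mathlib.RingTheory.LocalRing.Module
import HarnessLib

/-!
# Cohomology and base change in degree `0` from the vanishing of `H¹` of the closed fibre ALONE
# (Mumford, *Abelian Varieties*, §5 Cor. 3; Hartshorne III Thm. 12.11; EGA III 7.7.5 / 7.7.10)

Topic `Algebra/Module` (+ a complex wrapper in `Literature.Algebra.Homology`); a *proofs* file (theorems only; no definition,
no named fact, no instance).  Sequel to ★ `Algebra/Module/KernelBaseChangeDescent` (B-p04 (g18): the DESCENDING-INDUCTION
STEP `kerBaseChange_step` over a local ring, whose input is «`ker e` finite projective and commuting with base change») and ★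
`Algebra/Homology/VanishingBaseChangeOfQuasiIso` (transport to a flat quasi-isomorphic complex, with the fibre hypothesis in
ALL degrees `i ≥ q`).  Mumford §5 Cor. 3 / Hartshorne III 12.11 at the BOTTOM (`i = 1`) need only the vanishing of `H¹`
of the fibre: for `P —d→ Q —e→ W` finite projective over a local ring `(R, 𝔪, k)` with `e ∘ d = 0`, exactness of
`P ⊗ k → Q ⊗ k → W ⊗ k` says that the fibre of `ē : Q ⧸ im d → W` is injective, so `ē` is a SPLIT injection by Mathlib's
`IsLocalRing.split_injective_iff_lTensor_residueField_injective` («`l : M → N`, `M` finite, `N` finite free, is a split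
injection iff `k ⊗ l` is injective»), and then `ker e = im d` is finite projective and commutes with base change
(★ `ker_baseChange_of_surjective` for `Q ↠ Q ⧸ im d`) — exactly the input of `kerBaseChange_step`.  This matters
geometrically: Serre vanishing is in the tree for `Ȟ¹` only (★ `Modules/SerreVanishingTwist`), so «sections of the fibre lift
when `H¹(X_y, L_y) = 0`» must not ask for `Hⁱ = 0`, `i ≥ 2`.

* §1 `Literature.Algebra.Module.exists_splitting_liftQ_of_exact_residueField` (the split), and
  **`kerBaseChange_of_exact_residueField_one`**: `ker d` finite projective; `B ⊗ ker d → B ⊗ P` injective with range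
  `ker (d ⊗ B)` for EVERY `R`-algebra `B`; `P ⊗ B → Q ⊗ B → W ⊗ B` exact for every `B`;
* §2 `Literature.Algebra.Homology.kerBaseChange_of_exact_residueField_one_complex` — the same for the degrees `0, 1, 2` of a
  strictly perfect `CochainComplex (ModuleCat R) ℤ`;
* §3 **`exact_baseChange_one_of_quasiIso_of_exact_residueField_one`**,
  **`range_kerSubtype_baseChange_eq_ker_of_quasiIso_of_exact_one`** — transport along a quasi-isomorphism `ψ : P• → C•`
  to a termwise FLAT complex `C•` (the Čech complex of a proper flat scheme; ★ `Modules/GrothendieckComplexOfProper`):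
  if `C• ⊗ k` is exact in degree `1` then `C• ⊗ B` is exact in degree `1` and `B ⊗ Z⁰(C•) → B ⊗ C⁰` has range
  `ker(d⁰_C ⊗ B)` for every `B` — «every section of the fibre lifts», the proofs of ★ `VanishingBaseChangeOfQuasiIso` §3–§4
  verbatim with §2 in place of the all-degrees step.

Everything is proved; no named facts.  Mathlib searched (pin): `IsLocalRing.split_injective_iff_lTensor_residueField_injective`,
`Module.free_of_flat_of_isLocalRing`, `Module.Projective.of_split`, `Submodule.liftQ_mkQ`, `LinearMap.lTensor_surjective`,
`LinearMap.ker_comp_of_ker_eq_bot`, `LinearMap.baseChange_comp` (used); Mathlib has Nakayama and the local split criterion but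
no cohomology-and-base-change statement.  Cell `hodgecm-mathlib`, F-DAG (h2) «cohomology and base change» (B-p04 (g18) author,
closed; geometric assembly B-p19 (g14)); generic, count-neutral, books 0.

## References

* D. Mumford, *Abelian Varieties*, TIFR Studies in Mathematics 5 (1970), §5, Lemma 2 (p. 49), Cor. 3 (p. 53). [MumfordAV1970]
* R. Hartshorne, *Algebraic Geometry*, GTM 52 (1977), III Thm. 12.11 (p. 290). [Hartshorne1977]
* A. Grothendieck, EGA III₂ (Publ. Math. IHÉS 17, 1963), 7.7.5, 7.7.10. [EGAIII2]
-/

noncomputable section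

universe u

open TensorProduct

namespace Literature.Algebra.Module

/-! ## §1 The step at the bottom: `H¹(fibre) = 0` alone -/

section HOne

variable {R : Type u} [CommRing R] [IsLocalRing R]
  {P Q W : Type u} [AddCommGroup P] [Module R P] [AddCommGroup Q] [Module R Q] [AddCommGroup W] [Module R W]
  (d : P →ₗ[R] Q) (e : Q →ₗ[R] W) (hde : e ∘ₗ d = 0)

include hde in
/-- **`H¹` of the closed fibre detects a split**: over a local ring `(R, 𝔪, k)`, for `P —d→ Q —e→ W` with `e ∘ d = 0`, `Q`
finite and `W` finite projective, if `P ⊗ k → Q ⊗ k → W ⊗ k` is exact then the induced map `ē : Q ⧸ im d → W` is a SPLIT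
INJECTION (its fibre `ē ⊗ k` is injective — exactness at `Q ⊗ k` — and Mathlib's
`IsLocalRing.split_injective_iff_lTensor_residueField_injective` applies since `W` is finite free); consequently
`ker e = im d`, `Q ⧸ im d` is projective, and `ker e` is a direct summand of `Q`.
[cite: MumfordAV1970, §5 Cor. 3 (p. 53)] [cite: Hartshorne1977, III Thm. 12.11 (p. 290)] -/
theorem exists_splitting_liftQ_of_exact_residueField [Module.Finite R Q] [Module.Finite R W] [Module.Projective R W]
    (hex : Function.Exact (d.baseChange (IsLocalRing.ResidueField R)) (e.baseChange (IsLocalRing.ResidueField R))) :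
    ∃ l : W →ₗ[R] Q ⧸ LinearMap.range d,
      l ∘ₗ (LinearMap.range d).liftQ e (LinearMap.range_le_ker_iff.2 hde) = LinearMap.id := by
  set ē := (LinearMap.range d).liftQ e (LinearMap.range_le_ker_iff.2 hde) with hē
  haveI : Module.Flat R W := inferInstance
  haveI : Module.Free R W := Module.free_of_flat_of_isLocalRing
  refine (IsLocalRing.split_injective_iff_lTensor_residueField_injective ē).2 ?_
  -- `ē ⊗ k` is injective: exactness of `P ⊗ k → Q ⊗ k → W ⊗ k` at the middle term
  set κ := IsLocalRing.ResidueField R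
  have hq : Function.Surjective ((LinearMap.range d).mkQ.lTensor κ) :=
    LinearMap.lTensor_surjective κ (Submodule.mkQ_surjective _)
  rw [injective_iff_map_eq_zero]
  intro x hx
  obtain ⟨y, rfl⟩ := hq x
  -- `(e ⊗ k) y = (ē ⊗ k) ((q ⊗ k) y) = 0`
  have hy : (e.baseChange κ) y = 0 := by
    rw [LinearMap.baseChange_eq_ltensor]
    have : e = ē ∘ₗ (LinearMap.range d).mkQ := (Submodule.liftQ_mkQ _ _ _).symm
    rw [this, LinearMap.lTensor_comp, LinearMap.comp_apply, hx]
  -- so `y = (d ⊗ k) z` and `(q ⊗ k) y = ((q ∘ d) ⊗ k) z = 0`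
  obtain ⟨z, rfl⟩ := (hex y).1 hy
  rw [LinearMap.baseChange_eq_ltensor, ← LinearMap.comp_apply, ← LinearMap.lTensor_comp,
    (LinearMap.range_le_ker_iff (f := d) (g := (LinearMap.range d).mkQ)).1 (by rw [Submodule.ker_mkQ]),
    LinearMap.lTensor_zero, LinearMap.zero_apply]

include hde in
/-- **COHOMOLOGY AND BASE CHANGE IN DEGREE `0` FROM `H¹(fibre) = 0` ALONE** (Mumford §5 Cor. 2–3 at `p = 0, 1`;
Hartshorne III 12.11 with `i = 1`; EGA III 7.7.5 / 7.7.10).  Over a local ring `(R, 𝔪, k)`, let `P —d→ Q —e→ W` with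
`e ∘ d = 0`, `P`, `Q`, `W` finite projective (three consecutive terms of a strictly perfect complex), and suppose ONLY that
`P ⊗ k → Q ⊗ k → W ⊗ k` is exact (`H¹` of the fibre complex vanishes).  Then: (1) `ker d` (= `H⁰`) is finite projective;
(2) for every `R`-algebra `B`, `B ⊗ ker d → B ⊗ P` is injective with range `ker (d ⊗ B)` (`H⁰` commutes with base change);
(3) `P ⊗ B → Q ⊗ B → W ⊗ B` is exact for every `B` (`H¹` vanishes universally).  No hypothesis on the higher fibre
cohomology is needed (contrast ★ `kerBaseChange_step`, whose input `ker e` finite projective with base change is here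
PRODUCED from the exactness at `Q ⊗ k` by `exists_splitting_liftQ_of_exact_residueField`).
[cite: MumfordAV1970, §5 Cor. 3 (p. 53)] [cite: Hartshorne1977, III Thm. 12.11 (p. 290)] -/
theorem kerBaseChange_of_exact_residueField_one [Module.Finite R P] [Module.Projective R P] [Module.Finite R Q]
    [Module.Projective R Q] [Module.Finite R W] [Module.Projective R W]
    (hex : Function.Exact (d.baseChange (IsLocalRing.ResidueField R)) (e.baseChange (IsLocalRing.ResidueField R))) :
    (Module.Finite R (LinearMap.ker d) ∧ Module.Projective R (LinearMap.ker d)) ∧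
      (∀ (B : Type u) [CommRing B] [Algebra R B],
        Function.Injective ((LinearMap.ker d).subtype.baseChange B) ∧
          LinearMap.range ((LinearMap.ker d).subtype.baseChange B) = LinearMap.ker (d.baseChange B)) ∧
      ∀ (B : Type u) [CommRing B] [Algebra R B], Function.Exact (d.baseChange B) (e.baseChange B) := by
  obtain ⟨l, hl⟩ := exists_splitting_liftQ_of_exact_residueField d e hde hex
  set q := (LinearMap.range d).mkQ with hq
  set ē := (LinearMap.range d).liftQ e (LinearMap.range_le_ker_iff.2 hde) with hē
  have heq : e = ē ∘ₗ q := (Submodule.liftQ_mkQ _ _ _).symm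
  have hēinj : Function.Injective ē := fun x y h => by
    have := congrArg l h
    rwa [← LinearMap.comp_apply, ← LinearMap.comp_apply, hl] at this
  -- `ē ⊗ B` is injective for every `B` (a split injection stays one)
  have hēB : ∀ (B : Type u) [CommRing B] [Algebra R B], Function.Injective (ē.baseChange B) := by
    intro B _ _ x y h
    have := congrArg (l.baseChange B) h
    rwa [← LinearMap.comp_apply, ← LinearMap.comp_apply, ← LinearMap.baseChange_comp, hl, LinearMap.baseChange_id,
      LinearMap.id_apply, LinearMap.id_apply] at this
  -- `ker e = ker q = im d`
  have hker : LinearMap.ker e = LinearMap.ker q := by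
    rw [heq, LinearMap.ker_comp_of_ker_eq_bot _ (LinearMap.ker_eq_bot.2 hēinj)]
  -- `Q ⧸ im d` is projective (a direct summand of `W`), so `q : Q ↠ Q ⧸ im d` has a finite projective kernel commuting
  -- with base change (★ `ker_baseChange_of_surjective`)
  haveI : Module.Projective R (Q ⧸ LinearMap.range d) := Module.Projective.of_split ē l hl
  have hZ := ker_baseChange_of_surjective q (Submodule.mkQ_surjective _)
  rw [← hker] at hZ
  have hZbc : ∀ (B : Type u) [CommRing B] [Algebra R B],
      Function.Injective ((LinearMap.ker e).subtype.baseChange B) ∧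
        LinearMap.range ((LinearMap.ker e).subtype.baseChange B) = LinearMap.ker (e.baseChange B) := by
    intro B _ _
    refine ⟨(hZ.2 B).1, ?_⟩
    rw [(hZ.2 B).2, heq, LinearMap.baseChange_comp, LinearMap.ker_comp_of_ker_eq_bot _ (LinearMap.ker_eq_bot.2 (hēB B))]
  exact kerBaseChange_step d e hde hZ.1 hZbc hex

end HOne

end Literature.Algebra.Module

namespace Literature.Algebra.Homology

open CategoryTheory Literature.Algebra.Module

/-! ## §2 On a strictly perfect complex: degrees `0, 1, 2` -/

section Complex

variable {R : Type u} [CommRing R] [IsLocalRing R] (K : CochainComplex (ModuleCat.{u} R) ℤ)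

omit [IsLocalRing R] in
/-- `d¹ ∘ d⁰ = 0` on underlying linear maps. [cite: MumfordAV1970, §5 Lemma 2 (p. 49)] -/
theorem hom_d_one_two_comp_hom_d_zero_one : (K.d 1 2).hom ∘ₗ (K.d 0 1).hom = 0 := by
  rw [← ModuleCat.hom_comp, K.d_comp_d, ModuleCat.hom_zero]

/-- **`H⁰` of a strictly perfect complex over a local ring commutes with every base change, and `H¹ ⊗ B = 0`, as soon as
`H¹(K• ⊗ k) = 0`** (only the degree-`1` fibre vanishing; Mumford §5 Cor. 3 / Hartshorne III 12.11 at `i = 1`).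
[cite: MumfordAV1970, §5 Cor. 3 (p. 53)] [cite: Hartshorne1977, III Thm. 12.11 (p. 290)] -/
theorem kerBaseChange_of_exact_residueField_one_complex
    (hK : ∀ n, Module.Finite R (K.X n) ∧ Module.Projective R (K.X n))
    (hfib : Function.Exact ((K.d 0 1).hom.baseChange (IsLocalRing.ResidueField R))
      ((K.d 1 2).hom.baseChange (IsLocalRing.ResidueField R))) :
    (Module.Finite R (LinearMap.ker (K.d 0 1).hom) ∧ Module.Projective R (LinearMap.ker (K.d 0 1).hom)) ∧
      (∀ (B : Type u) [CommRing B] [Algebra R B],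
        Function.Injective ((LinearMap.ker (K.d 0 1).hom).subtype.baseChange B) ∧
          LinearMap.range ((LinearMap.ker (K.d 0 1).hom).subtype.baseChange B) =
            LinearMap.ker ((K.d 0 1).hom.baseChange B)) ∧
      ∀ (B : Type u) [CommRing B] [Algebra R B],
        Function.Exact ((K.d 0 1).hom.baseChange B) ((K.d 1 2).hom.baseChange B) := by
  haveI := (hK 0).1; haveI := (hK 0).2; haveI := (hK 1).1; haveI := (hK 1).2; haveI := (hK 2).1; haveI := (hK 2).2
  exact kerBaseChange_of_exact_residueField_one (K.d 0 1).hom (K.d 1 2).hom (hom_d_one_two_comp_hom_d_zero_one K) hfib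

end Complex

/-! ## §3 Transport to a flat quasi-isomorphic complex (the Čech complex): sections of the fibre lift -/

section Transport

variable {R : Type u} [CommRing R] {P C : CochainComplex (ModuleCat.{u} R) ℤ} (ψ : P ⟶ C)

/-- **`H¹ ⊗ B = 0` for every `B` from `H¹ ⊗ k = 0`, on the flat complex** (Mumford §5 Lemma 2 + Cor. 3 at `i = 1`): `R` local,
`ψ : P• → C•` a quasi-isomorphism of complexes zero above degree `N`, `P•` strictly perfect, `C•` termwise flat.
[cite: MumfordAV1970, §5 Cor. 3 (p. 53)] [cite: Hartshorne1977, III Thm. 12.11 (p. 290)] -/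
theorem exact_baseChange_one_of_quasiIso_of_exact_residueField_one [IsLocalRing R] [QuasiIso ψ] (N : ℤ)
    [P.IsStrictlyLE N] [C.IsStrictlyLE N]
    (hP : ∀ n, Module.Finite R (P.X n) ∧ Module.Projective R (P.X n)) (hC : ∀ n, Module.Flat R (C.X n))
    (hfib : Function.Exact ((C.d 0 1).hom.baseChange (IsLocalRing.ResidueField R))
      ((C.d 1 2).hom.baseChange (IsLocalRing.ResidueField R)))
    (B : Type u) [CommRing B] [Algebra R B] :
    Function.Exact ((C.d 0 1).hom.baseChange B) ((C.d 1 2).hom.baseChange B) := by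
  have hPf := flat_X_of_finite_projective hP
  have hfib' : Function.Exact ((C.d (1 - 1) 1).hom.baseChange (IsLocalRing.ResidueField R))
      ((C.d 1 (1 + 1)).hom.baseChange (IsLocalRing.ResidueField R)) := hfib
  have hfibP : Function.Exact ((P.d 0 1).hom.baseChange (IsLocalRing.ResidueField R))
      ((P.d 1 2).hom.baseChange (IsLocalRing.ResidueField R)) :=
    (function_exact_baseChange_iff_of_quasiIso ψ hPf hC N _ 1).2 hfib'
  have h := (kerBaseChange_of_exact_residueField_one_complex P hP hfibP).2.2 B
  have h' : Function.Exact ((P.d (1 - 1) 1).hom.baseChange B) ((P.d 1 (1 + 1)).hom.baseChange B) := h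
  exact (function_exact_baseChange_iff_of_quasiIso ψ hPf hC N B 1).1 h'

/-- **EVERY SECTION OF THE FIBRE LIFTS, from `H¹` of the fibre alone** (Mumford §5 Cor. 3 at `p = 1` / Hartshorne III 12.11
(a)+(b) with `i = 1` / EGA III 7.7.10, surjectivity half, for every base change, on the flat complex): `R` local with
residue field `k`; `ψ : P• → C•` a quasi-isomorphism of complexes in degrees `[0, N]`, `P•` strictly perfect, `C•` termwise
flat; if `C• ⊗ k` is exact in degree `1`, then for every `R`-algebra `B` the map `B ⊗ Z⁰(C•) → B ⊗ C⁰` has range exactly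
`ker (d⁰_C ⊗ B)` (`= H⁰(C• ⊗ B)`).  (★ `range_kerSubtype_baseChange_eq_ker_of_quasiIso` assumes exactness in ALL degrees
`≥ 1`; the proof is the same with §2 in place of the descending induction.)
[cite: MumfordAV1970, §5 Cor. 3 (p. 53)] [cite: Hartshorne1977, III Thm. 12.11 (p. 290)] -/
theorem range_kerSubtype_baseChange_eq_ker_of_quasiIso_of_exact_one [IsLocalRing R] [QuasiIso ψ] (N : ℤ)
    [P.IsStrictlyLE N] [C.IsStrictlyLE N] [P.IsStrictlyGE 0] [C.IsStrictlyGE 0]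
    (hP : ∀ n, Module.Finite R (P.X n) ∧ Module.Projective R (P.X n)) (hC : ∀ n, Module.Flat R (C.X n))
    (hfib : Function.Exact ((C.d 0 1).hom.baseChange (IsLocalRing.ResidueField R))
      ((C.d 1 2).hom.baseChange (IsLocalRing.ResidueField R)))
    (B : Type u) [CommRing B] [Algebra R B] :
    LinearMap.range ((LinearMap.ker (C.d 0 1).hom).subtype.baseChange B) =
      LinearMap.ker ((C.d 0 1).hom.baseChange B) := by
  refine le_antisymm (range_kerSubtype_baseChange_le_ker C B 0 1) ?_
  intro w' hw'
  have hPf := flat_X_of_finite_projective hP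
  have hfib' : Function.Exact ((C.d (1 - 1) 1).hom.baseChange (IsLocalRing.ResidueField R))
      ((C.d 1 (1 + 1)).hom.baseChange (IsLocalRing.ResidueField R)) := hfib
  have hfibP : Function.Exact ((P.d 0 1).hom.baseChange (IsLocalRing.ResidueField R))
      ((P.d 1 2).hom.baseChange (IsLocalRing.ResidueField R)) :=
    (function_exact_baseChange_iff_of_quasiIso ψ hPf hC N _ 1).2 hfib'
  -- `Z⁰(P•)` commutes with base change (§2, conjunct 2)
  have hPbc := ((kerBaseChange_of_exact_residueField_one_complex P hP hfibP).2.1 B).2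
  -- pull `w'` back along the bijection `Ker(d⁰_P ⊗ B) → Ker(d⁰_C ⊗ B)`
  obtain ⟨w, hw⟩ := (kerZeroBaseChangeMap_bijective ψ B hPf hC N).2 ⟨w', hw'⟩
  have hwP : (w : B ⊗[R] P.X 0) ∈ LinearMap.range ((LinearMap.ker (P.d 0 1).hom).subtype.baseChange B) := by
    rw [hPbc]
    exact w.2
  obtain ⟨t, ht⟩ := hwP
  refine ⟨(kerZeroMap ψ).baseChange B t, ?_⟩
  rw [← LinearMap.comp_apply, ← LinearMap.baseChange_comp, kerSubtype_comp_kerZeroMap, LinearMap.baseChange_comp,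
    LinearMap.comp_apply, ht, ← coe_kerZeroBaseChangeMap_apply, hw]

end Transport

end Literature.Algebra.Homology

end
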